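import Summits.QuantumFields.YangMills.Theorems.UnitScaleTiltHalvingP1FlatCoreSupplierRestr129
import Literature.MathematicalPhysics.QuantumFieldTheory.Balaban1983to89.B8SectEInLambdaWitness
import Literature.Analysis.Complex.RungeUnits
import HarnessLib

/-!
# `hP1room` PROGRAMME, THIN ROAD γ, (M2′) «mixed-end top (1.42)»: ★★ THE (84)∕(178)∕(214) DICTIONARY — CORE, N05 LETTERS (FILE A of 2)

Route `UnitScaleTilt`, crux K1 child «MinimiserStabilityRegPr» (stmt-QuantumFields-19200), registered stub `stub_halvingStep` (`BirthV10`), display v7γ ∕ ρ5 door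
(★★OWNER RULING g28-№14, LEAD-H ★w5-19200 g7 WORDS 13∕17: «(a)-row, (O2) processed row — the composer v3.3 calls the dictionary internally and displays the
(a-row) as one more antecedent of `H42topCrossT`»).  Cell `ym3-torus` (HUMAN RULING D-0037: YM₃ on T³ is rung R3 — NOT d = 4, NOT infinite volume, NOT a mass gap,
NOT the Clay problem), width seat `ym-ust-20520-w5` gen 9.  `--supports stmt-QuantumFields-19200 --as helper`; THEOREMS ONLY (0 `def`, 0 `sorry`); count-neutral;
nothing here claims (M2′), `H42topCrossT`, the stub or the gap.

WHY (w5 LOCATE-2 61dadb20 §1∕§3, LOCATE-4∕5).  At a crossing top bond `c = ⟨y_out, y_in⟩` of the collar class the double-bar variable of the knit factors as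
`E(y_out)⁻¹·Ũ♯(c)·E(y_in)` with `E = (R̄₀u₀)^{(k)}`, `u₀ = u₁·e^{iλ′}` ([3] (92)∘(71)∘(84)); (R2) gives `E(y_out) = 1`, and `E(y_in)` is read through the knit's
torus frame `κf_k(π y_in) = a(y_in)` (`htopId`).  THIS FILE is the `ℤᵈ` half of «`E(y_in)·κf_k(π y_in) ≈ 1`» at ONE top site, in N05's letters, for an ABSTRACT unit
`V` standing for `κf_k(π y)`:
* §0 `norm_inv_mul_sub_one_le_of_exp` ∕ `_two_mul` — `‖U⁻¹V − 1‖ ≤ e^{2a+r}·r ≤ 2r` for `U = e^A`, `V = e^B`, `‖A‖ ≤ a ≤ 1∕25`, `‖A − B‖ ≤ r ≤ ½`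
  (✓`Literature.Analysis.Complex.norm_exp_sub_exp_le`, ✓`B7Transfer.norm_exp_sub_one_le_of_le`).
* §1 ★★`uavg_product_mul_sub_one_le` — binders = ✓`HalvingP1FlatCoreSupplierRestr129.restr129_product_of_topRows`' VERBATIM (minus `(lo)`, plus `hs₇`), one top
  site `y ∈ Λs (m+1) (m+1)`, a unit `V` with `exp (log V) = V` and `‖log V − Q′_{m+1}(−iλ′)(y)‖ ≤ Cb_T` (N05's linear restriction functional
  `QprimeIter (zdBlocking d L) (bgT L 1)`), window `θ := C2p·(40d·c_B + 2α₄)·2α₄ + Cb_T ≤ ½` ⟹ `‖(R̄₀(u₁e^{iλ′}))^{m+1}(y)·V − 1‖ ≤ 2θ`.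
  MECHANISM: the unitary tower witness of `u₁` at `(m+1, y)` exactly as ✓p`…SupplierRestr129` builds it (masked datum ✓`exists_masked_datum`, N05's binders
  ✓`h33_of_inAk` ✓`hP_of_datum` ✓`h69_of_datum` ✓`inAx_mgauge_expCfg_of_datum` ✓`restr129_succ_of_truncation`, ✓`glev_on_towers_of_axial` ∘ ✓`witness_unitary_of_glev`),
  the witnesses of `u₁⁻¹` (✓`witness_inv_of_unitary`) and of `e^{−iλ′}u₁⁻¹` (✓`witness_mul_of207`, (207)-rows of `−iλ′` off (1.108) on the tower bonds); then
  ✓`uavg_inv_tower_of_witness` twice + ✓`utilG_eq_uavg_mul_inv` + (1.29) at `(m+1, y)` give `(R̄₀(u₁e^{iλ′}))^{m+1}(y) = (ũ′^{m+1}(e^{−iλ′}, u₁⁻¹)(y))⁻¹`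
  EXACTLY (the pattern of lit ✓`restr129_mul_inv_of_cond179_local`); (204) ✓`prop10_tower_of_witness` puts `ũ′` in the log domain, (214) ✓`eq214_tower_of_witness`
  bounds `‖Q′(u₁⁻¹, −iλ′) − Q′_{m+1}(−iλ′)‖ ≤ C2p(α₃ + 2α₄)·2α₄`, and §0 concludes.
FILE B (`…TopCrossingDictionary.lean`) instantiates at the member with the torus (E) row of ✓`HalvingHSiteTorusBlocks.siteTorusBlocks_of_datum` and (S2).
HONEST SCOPE: by-name composition + one exponential estimate; nothing of [Balaban1985Averaging] Prop. 10, [Balaban1985RegularSpaces] Prop. 5 ∕ Thm 4, (M2′) or the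
stub is proved here.

References: T. Bałaban, CMP **98** (1985) 17–51 [Balaban1985Averaging] ((78)–(80) p.30, (84)–(86) p.33, (166)–(167) p.44, (178) p.45, Prop. 10 (203)–(214) p.50);
CMP **99** (1985) 75–102 [Balaban1985RegularSpaces] ((1.29) p.81, (1.68)–(1.69) p.88, (1.78)–(1.79) p.90, (1.108) p.94, (1.112)–(1.121) pp.95–96).
-/

set_option autoImplicit false

noncomputable section

open scoped BigOperators Matrix.Norms.L2Operator
open NormedSpace
open Complex (I)

namespace Summit.QuantumFields.YangMills.Theorems.HalvingTopCrossingDictionaryCore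

open Literature.MathematicalPhysics.QuantumFieldTheory.Balaban1983to89
open B7Prop1Explicit (e expUnit val_expUnit val_inv_expUnit)
open B7Prop2Explicit (unitaryUnits C0 c2')
open B7Prop3Flat (c3)
open B7Prop10General (C6 C4G utilG)
open B7Prop10Flat (one_le_C5)
open B7Prop9Flat (C5')
open B7Prop1Local (InBox pdevOn clampCfg)
open B7Eq167Flat (InLambda)
open B7Eq170Flat (cj)
open B7Eq92Concrete (mgauge)
open B7Eq84Concrete (uavg)
open B7Eq78Linearization (QprimeIter zdBlocking)
open B7Eq214General (Cgen)
open B8Ineq125Concrete (C2p)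
open B8Ineq130 (tlo thi tlo_zero thi_zero)
open B8Ineq132 (covDerivFwd InAk)
open B8Eq119TwistedAxial (Restr129 InAx bgT)
open B8Eq184Proof (gaugeExp cfgExp)
open B8Lemma1NonAbelian (mulCfg)
open B8Eq140Level (SideTouches)
open B8Eq146AExpansion (iEta)
open B8Thm2LogB (norm_negI_smul)
open B8Eq155JBound (expCfg_iEta_mem_unitaryUnits)
open B8LambdaSpaceKLevel (wt)
open B8Eq178Averages (Qnl Qnl_eq_mlog_utilG utilG_eq_uavg_mul_inv restr129_iff_uavg)
open B8Eq1123Concrete (cj_smul_complex)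
open B8Prop5JoinSectE (cjDiff_le_of_weighted)
open B8Prop5SocketDatum (exists_masked_datum restr129_succ_of_truncation sideTouches_of_tower_bond h33_of_inAk hP_of_datum h69_of_datum)
open B8SockHFPAssembly (inAx_mgauge_expCfg_of_datum)
open B8SectEInLambdaWitness (witness_unitary_of_glev witness_inv_of_unitary eq214_tower_of_witness)
open B8Eq1117KLevel (glev_on_towers_of_axial)
open B8Restr129InversionLocal (uavg_inv_tower_of_witness witness_mul_of207 dom178_tower_of_witness)
open B7Prop2Explicit (avgClosed_unitaryUnits)
open MatrixLog (mlog exp_mlog norm_mlog_le_two_mul)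
open Literature.MathematicalPhysics.QuantumLattice (blockSites)

/-! ## §0 `‖U⁻¹V − 1‖` from the logarithms -/

section ExpAlgebra

variable {𝔄 : Type*} [NormedRing 𝔄] [NormedAlgebra ℂ 𝔄] [CompleteSpace 𝔄] [NormOneClass 𝔄]

/-- **`‖U⁻¹V − 1‖ ≤ e^{2a+r}·r` FOR `U = e^A`, `V = e^B`, `‖A‖ ≤ a`, `‖A − B‖ ≤ r`** — `U⁻¹V − 1 = e^{−A}(e^B − e^A)`, `‖e^{−A}‖ ≤ e^a`,
`‖e^B − e^A‖ ≤ ‖B − A‖·e^{max(‖A‖,‖B‖)}` (✓`Literature.Analysis.Complex.norm_exp_sub_exp_le`). [folklore] -/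
theorem norm_inv_mul_sub_one_le_of_exp {U V : 𝔄ˣ} {A B : 𝔄} (hU : (U : 𝔄) = exp A) (hV : (V : 𝔄) = exp B)
    {a r : ℝ} (hA : ‖A‖ ≤ a) (hAB : ‖A - B‖ ≤ r) :
    ‖((U⁻¹ * V : 𝔄ˣ) : 𝔄) - 1‖ ≤ Real.exp (2 * a + r) * r := by
  have hr0 : 0 ≤ r := (norm_nonneg _).trans hAB
  have hB : ‖B‖ ≤ a + r := by
    have h : B = A - (A - B) := by abel
    rw [h]; exact (norm_sub_le _ _).trans (add_le_add hA hAB)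
  have hUunit : U = expUnit A := Units.ext (by rw [hU, val_expUnit])
  have hUinv : ((U⁻¹ : 𝔄ˣ) : 𝔄) = exp (-A) := by rw [hUunit, val_inv_expUnit, val_expUnit]
  have hkey : ((U⁻¹ * V : 𝔄ˣ) : 𝔄) - 1 = ((U⁻¹ : 𝔄ˣ) : 𝔄) * ((V : 𝔄) - U) := by
    rw [Units.val_mul, mul_sub, Units.inv_mul]
  have h1 : ‖((U⁻¹ : 𝔄ˣ) : 𝔄)‖ ≤ Real.exp a := by
    have h := B7Transfer.norm_exp_sub_one_le_of_le (-A) (β := a) (by rwa [norm_neg])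
    have h' : ‖exp (-A)‖ ≤ ‖exp (-A) - 1‖ + ‖(1 : 𝔄)‖ := by
      have h'' := norm_add_le (exp (-A) - 1) (1 : 𝔄); rwa [sub_add_cancel] at h''
    rw [hUinv]; rw [norm_one] at h'; linarith
  have h2 : ‖(V : 𝔄) - U‖ ≤ r * Real.exp (a + r) := by
    rw [hU, hV]
    have hmax : max ‖B‖ ‖A‖ ≤ a + r := max_le hB (by linarith)
    calc ‖exp B - exp A‖ ≤ ‖B - A‖ * Real.exp (max ‖B‖ ‖A‖) := Literature.Analysis.Complex.norm_exp_sub_exp_le B A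
      _ ≤ r * Real.exp (a + r) := mul_le_mul (by rwa [norm_sub_rev]) (Real.exp_le_exp.2 hmax) (by positivity) hr0
  calc ‖((U⁻¹ * V : 𝔄ˣ) : 𝔄) - 1‖ = ‖((U⁻¹ : 𝔄ˣ) : 𝔄) * ((V : 𝔄) - U)‖ := by rw [hkey]
    _ ≤ ‖((U⁻¹ : 𝔄ˣ) : 𝔄)‖ * ‖(V : 𝔄) - U‖ := norm_mul_le _ _
    _ ≤ Real.exp a * (r * Real.exp (a + r)) := mul_le_mul h1 h2 (norm_nonneg _) (by positivity)
    _ = Real.exp (2 * a + r) * r := by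
        rw [show Real.exp (2 * a + r) = Real.exp a * Real.exp a * Real.exp r by rw [two_mul, Real.exp_add, Real.exp_add],
          Real.exp_add]; ring

/-- The numeric form: `a ≤ 1∕25`, `r ≤ ½` ⇒ `e^{2a+r} ≤ e^{0.58} ≤ 2`, so `‖U⁻¹V − 1‖ ≤ 2r`. [folklore] -/
theorem norm_inv_mul_sub_one_le_two_mul {U V : 𝔄ˣ} {A B : 𝔄} (hU : (U : 𝔄) = exp A) (hV : (V : 𝔄) = exp B)
    {a r : ℝ} (hA : ‖A‖ ≤ a) (hAB : ‖A - B‖ ≤ r) (ha : a ≤ 1 / 25) (hr : r ≤ 1 / 2) :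
    ‖((U⁻¹ * V : 𝔄ˣ) : 𝔄) - 1‖ ≤ 2 * r := by
  have ha0 : 0 ≤ a := (norm_nonneg _).trans hA
  have hr0 : 0 ≤ r := (norm_nonneg _).trans hAB
  have hx0 : 0 ≤ 2 * a + r := by positivity
  have hx1 : 2 * a + r ≤ 29 / 50 := by linarith
  have habs : |2 * a + r| ≤ 1 := by rw [abs_of_nonneg hx0]; linarith
  have hq := (abs_le.1 (Real.abs_exp_sub_one_sub_id_le habs)).2
  have hexp : Real.exp (2 * a + r) ≤ 2 := by nlinarith
  calc ‖((U⁻¹ * V : 𝔄ˣ) : 𝔄) - 1‖ ≤ Real.exp (2 * a + r) * r := norm_inv_mul_sub_one_le_of_exp hU hV hA hAB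
    _ ≤ 2 * r := mul_le_mul_of_nonneg_right hexp hr0

end ExpAlgebra

/-! ## §1 THE ℤᵈ HALF at one top site: `(R̄₀(u₁e^{iλ′}))ᵏ(y) = (ũ′ᵏ(e^{−iλ′}, u₁⁻¹)(y))⁻¹` EXACTLY, (204)∕(214) for the inverse pair, and `‖(R̄₀(u₁e^{iλ′}))ᵏ(y)·V − 1‖` for any unit `V` whose logarithm is within `Cb_T` of `Q′_k(−iλ′)(y)` -/

section Core

open B7Prop1Explicit (Site)

variable {d : ℕ} {𝔸 : Type*} [CStarAlgebra 𝔸] [Nontrivial 𝔸]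

/-- ★★ **THE (84)∕(178)∕(214) DICTIONARY AT ONE TOP SITE, N05 LETTERS** (the binders of ✓`HalvingP1FlatCoreSupplierRestr129.restr129_product_of_topRows` VERBATIM minus `(lo)`,
plus `hs₇`, one top site `y ∈ Λs (m+1) (m+1)`, and an abstract unit `V` in the log domain whose logarithm is within `Cb_T` of N05's linear
restriction functional `Q′_{m+1}(−iλ′)(y)` at the flat background): with `θ := C2p·(40d·c_B + 2α₄)·2α₄ + Cb_T ≤ ½`,
`‖(R̄₀(u₁·e^{iλ′}))^{m+1}(y) · V − 1‖ ≤ 2θ`.  MECHANISM: unitary tower witness of `u₁` at `(m+1, y)` (✓`glev_on_towers_of_axial` ∘ ✓`witness_unitary_of_glev`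
on the masked datum), of `u₁⁻¹` (✓`witness_inv_of_unitary`) and of `e^{−iλ′}u₁⁻¹` (✓`witness_mul_of207`, (207)-rows of `−iλ′` read off (1.108) on the tower bonds);
✓`uavg_inv_tower_of_witness` twice + ✓`utilG_eq_uavg_mul_inv` + (1.29) at `(m+1, y)` give `(R̄₀(u₁e^{iλ′}))^{m+1}(y) = (ũ′^{m+1}(y))⁻¹` EXACTLY; (204) puts `ũ′` in the
log domain, (214) (✓`eq214_tower_of_witness`) bounds `‖log ũ′^{m+1}(y) − Q′_{m+1}(−iλ′)(y)‖`, and §0 concludes.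
[cite: Balaban1985Averaging, (84)-(86) p.33, (178) p.45, Prop. 10 (204) p.50, (207)-(214) p.50; Balaban1985RegularSpaces, (1.29) p.81, (1.78)-(1.79) p.90, (1.108) p.94, (1.112)-(1.121) pp.95-96] -/
theorem uavg_product_mul_sub_one_le (hd2 : 2 ≤ d) {L : ℕ} (hL : 2 ≤ L) {η : ℝ} (hη : 0 < η) {K₀ : ℕ}
    -- the member's geometry (domains, tower structures at `m` and `m+1`)
    {Ω : ℕ → Set (Site d)} (hΩ : ∀ j, Ω (j + 1) ⊆ Ω j) {Λs : ℕ → ℕ → Set (Site d)}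
    {m : ℕ} (hmk : m < K₀)
    (htower : ∀ j, j ≤ m + 1 → ∀ y ∈ Λs (m + 1) j, ∀ x, InBox (tlo L y j) (thi L y j) x → x ∈ Ω j)
    (hlt : ∀ j, j < m → Λs m j = Λs (m + 1) j)
    (htop : ∀ x, x ∈ Λs m m ↔ x ∈ Λs (m + 1) m ∨ ∃ y ∈ Λs (m + 1) (m + 1), x ∈ blockSites L y)
    -- constants, (1.33), (1.34), the axial class of the pre-gauged field `U′` at the flat background
    {α₀ α₁ B₀ cs α₄ : ℝ} (hα₀ : 0 < α₀) (hα₁ : 0 < α₁) (hB₀ : 0 < B₀) (hα₄ : 0 < α₄)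
    (hcs : cs = 5 * (d : ℝ) * L * B₀ * (α₀ + α₁))
    {U' : Site d → Fin d → 𝔸ˣ}
    (h33 : InAk L K₀ η α₀ Ω (1 : Site d → Fin d → 𝔸ˣ)) (h34 : InAk L K₀ η α₀ Ω (mulCfg U' 1))
    (hAx : ∀ m', m' ≤ K₀ → InAx L m' (Λs m') (1 : Site d → Fin d → 𝔸ˣ) (mulCfg U' 1))
    -- the datum at level `m`
    {u₁ : Site d → 𝔸ˣ} {U₁ : Site d → Fin d → 𝔸ˣ} {A : Site d → Fin d → 𝔸}
    (hu₁ : ∀ x, u₁ x ∈ unitaryUnits 𝔸) (hW : mgauge (1 : Site d → Fin d → 𝔸ˣ) u₁ U₁ = U') (h129 : Restr129 L m (Λs m) (1 : Site d → Fin d → 𝔸ˣ) u₁)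
    (hdat : ∀ j, j ≤ m → ∀ b ∈ {b : Site d × Fin d | SideTouches (Ω j) b.1 b.2},
      U₁ b.1 b.2 = cfgExp η A b.1 b.2 ∧ IsSelfAdjoint (A b.1 b.2) ∧ ‖A b.1 b.2‖ ≤ cs * ((L : ℝ) ^ j * η)⁻¹)
    -- the JOIN's scalar windows
    {cB : ℝ} (hcBlo : L * cs ≤ cB)
    (hα3 : C0 d * α₀ ≤ 1 / 3) (hα4 : 4 * α₀ ≤ c2' d L)
    (hsmall : Real.exp (4 * (800 * ((d : ℝ) + 1) ^ 2 * ((d : ℝ) + 4)) * α₀) * (1 + 8 * (131072 * ((d : ℝ) + 1) ^ 2) * cB) ≤ 2)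
    (hc₃ : 2 * cB ≤ c3 d L) (hsc : 2048 * (d : ℝ) * cB ≤ 1) (hα₃' : 40 * d * cB ≤ 1 / 200)
    (hs₁ : 200 * C6 d * (2 * α₄) ≤ 1) (hs₂ : 12000 * ((d : ℝ) + 1) * L * (2 * α₄) ≤ 1)
    (hs₃ : C4G d L * (α₀ + 40 * d * cB + 4 * (2 * α₄)) ≤ 1)
    (hs₄ : 1024 * ((d : ℝ) + 1) * ((d : ℝ) + 4) * L ^ 2 * α₀ ≤ 1) (hs₅ : 32 * ((d : ℝ) + 1) ^ 2 * C6 d * L ^ 2 * α₀ ≤ 1)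
    (hs₆ : 16 * d * C5' d * C6 d * (L : ℝ) ^ 2 * α₀ ≤ 1) (hs₇ : 8 * d * C6 d * L * α₀ ≤ 1)
    (hprod8 : 2 * C6 d * (40 * d * cB + 4 * α₄) ≤ 1 / 8)
    -- the top-step call's OUTPUT row (1.108) for `λ′` on the touched sides
    {lam : Site d → 𝔸}
    (h108 : ∀ j, j ≤ m + 1 → ∀ b ∈ {b : Site d × Fin d | SideTouches (Ω j) b.1 b.2},
      ‖lam b.1‖ ≤ α₄ ∧ wt L η j * ‖covDerivFwd η (1 : Site d → Fin d → 𝔸ˣ) b.2 lam b.1‖ ≤ α₄)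
    -- ONE top site, the torus-side unit `V` in the log domain with its logarithm row, and the remainder window
    {y : Site d} (hy : y ∈ Λs (m + 1) (m + 1)) {V : 𝔸ˣ} (hV : exp (mlog (V : 𝔸)) = V) {CbT : ℝ}
    (hVQ : ‖mlog (V : 𝔸) - QprimeIter (zdBlocking d L) (bgT L (1 : Site d → Fin d → 𝔸ˣ)) (m + 1) ((-I) • lam) y‖ ≤ CbT)
    (hwinT : C2p d * (40 * d * cB + 2 * α₄) * (2 * α₄) + CbT ≤ 1 / 2) :
    ‖((uavg L (1 : Site d → Fin d → 𝔸ˣ) (u₁ * gaugeExp lam) (m + 1) y : 𝔸ˣ) : 𝔸) * V - 1‖ ≤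
      2 * (C2p d * (40 * d * cB + 2 * α₄) * (2 * α₄) + CbT) := by
  subst hcs
  have hU₀ : ∀ (x : Site d) (κ : Fin d), (1 : Site d → Fin d → 𝔸ˣ) x κ ∈ unitaryUnits 𝔸 := fun _ _ => (unitaryUnits 𝔸).one_mem
  have hG := avgClosed_unitaryUnits d L (𝔸 := 𝔸)
  have hL1 : 1 ≤ L := le_trans (by norm_num) hL
  have hd1 : 1 ≤ d := le_trans (by norm_num) hd2
  have hLr : (1 : ℝ) ≤ L := by exact_mod_cast hL1
  have hmK : m + 1 ≤ K₀ := hmk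
  have hk : m + 1 ≤ m + 1 := le_rfl
  have hcs0 : 0 ≤ 5 * (d : ℝ) * L * B₀ * (α₀ + α₁) := by positivity
  have hcsB : 5 * (d : ℝ) * L * B₀ * (α₀ + α₁) ≤ cB := (le_mul_of_one_le_left hcs0 hLr).trans hcBlo
  have hcB0 : 0 ≤ cB := hcs0.trans hcsB
  have hαP2 : 2 * α₀ ≤ c2' d L := by linarith only [hα4, hα₀]
  have hC6 : (0 : ℝ) ≤ C6 d := by
    have : (2 : ℝ) ≤ C6 d := by unfold C6; linarith only [one_le_C5 (d := d)]
    linarith only [this]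
  have hα₃0 : (0 : ℝ) ≤ 40 * d * cB := by positivity
  have hα₃h : 40 * (d : ℝ) * cB < 1 / 2 := by linarith only [hα₃']
  have hLk : (0 : ℝ) < (L : ℝ) ^ (m + 1) := by positivity
  -- the MASKED exponent `A′` of the datum and N05's datum binders BY NAME (as ✓`restr129_product_of_topRows`)
  obtain ⟨A', hsa, _, hWA, _⟩ := exists_masked_datum hdat
  have hWA1 : ∀ j, j ≤ m → ∀ (y : Site d) (τ : Fin d), SideTouches (Ω j) y τ → U₁ y τ = cfgExp η A' y τ :=
    fun j hj y τ hs => (hWA j hj y τ hs).1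
  have h41 : ∀ j, j ≤ m → ∀ (y : Site d) (τ : Fin d), SideTouches (Ω j) y τ →
      ‖A' y τ‖ ≤ (5 * (d : ℝ) * L * B₀ * (α₀ + α₁)) * ((L : ℝ) ^ j * η)⁻¹ := fun j hj y τ hs => (hWA j hj y τ hs).2
  have h33' := h33_of_inAk hL1 hα₀ h33 hmK htower
  have hP' := hP_of_datum hL1 hα₀ hΩ h34 hmK htower hu₁ hW hWA1
  have h69' : ∀ j, j ≤ m + 1 → ∀ y ∈ Λs (m + 1) j, ∀ (x : Site d) (κ : Fin d), InBox (tlo L y j) (thi L y j) x →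
      InBox (tlo L y j) (thi L y j) (x + e κ) → ‖iEta η A' x κ‖ ≤ cB * ((L : ℝ) ^ j)⁻¹ :=
    fun j hj y hy x κ hx hxe =>
      (h69_of_datum hd2 hL1 hη hΩ htower hcs0 h41 j hj y hy x κ hx hxe).trans (mul_le_mul_of_nonneg_right hcBlo (by positivity))
  have hBu : ∀ (x : Site d) (κ : Fin d), B8Eq146AExpansion.expCfg (iEta η A') x κ ∈ unitaryUnits 𝔸 := expCfg_iEta_mem_unitaryUnits η hsa
  have hAx' : InAx L (m + 1) (Λs (m + 1)) (1 : Site d → Fin d → 𝔸ˣ)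
      (mgauge (1 : Site d → Fin d → 𝔸ˣ) u₁ (B8Eq146AExpansion.expCfg (iEta η A')) * (1 : Site d → Fin d → 𝔸ˣ)) :=
    inAx_mgauge_expCfg_of_datum hd2 hL1 hΩ htower hW hWA1 (hAx (m + 1) hmK)
  have h129' : Restr129 L (m + 1) (Λs (m + 1)) (1 : Site d → Fin d → 𝔸ˣ) u₁ := restr129_succ_of_truncation hL1 hlt htop h129
  -- the unitary tower witness of `u₁` at `(m+1, y)` (radius `40·d·c_B`)
  have hglev := glev_on_towers_of_axial hL1 (Λs (m + 1)) hAx' h129'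
  obtain ⟨ut, hun, hWt, hag⟩ := witness_unitary_of_glev hd1 hL hU₀ hα₀ hα3 hα4 (h33' (m + 1) hk y hy) hcB0 hsmall hc₃ hsc hα₀ hα3 hαP2 hL1 hBu
    (h69' (m + 1) hk y hy) (hP' (m + 1) hk y hy) (hglev (m + 1) hk y hy)
  -- the (207)-rows of `−iλ′` on the tower `B^{m+1}(y)` at `2α₄`, from (1.108) on the tower bonds
  have hκ₀ : Fin d := ⟨0, by omega⟩
  have h177b : ∀ x : Site d, InBox (tlo L y (m + 1)) (thi L y (m + 1)) x → ‖((-I) • lam) x‖ < 2 * α₄ := by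
    intro x hx
    rw [Pi.smul_apply, norm_negI_smul]
    have h := (h108 (m + 1) hk (x, hκ₀) (sideTouches_of_tower_bond hd2 htower hk hy x hκ₀ hx)).1
    linarith only [h, hα₄]
  have h177a : ∀ (x : Site d) (κ : Fin d), InBox (tlo L y (m + 1)) (thi L y (m + 1)) x →
      InBox (tlo L y (m + 1)) (thi L y (m + 1)) (x + e κ) →
      ‖cj ((1 : Site d → Fin d → 𝔸ˣ) x κ) (((-I) • lam) (x + e κ)) - ((-I) • lam) x‖ < 2 * α₄ * ((L : ℝ) ^ (m + 1))⁻¹ := by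
    intro x κ hx _
    have hLj : (0 : ℝ) < ((L : ℝ) ^ (m + 1))⁻¹ := by positivity
    have hgrad := (h108 (m + 1) hk (x, κ) (sideTouches_of_tower_bond hd2 htower hk hy x κ hx)).2
    rw [Pi.smul_apply, Pi.smul_apply, cj_smul_complex, ← smul_sub, norm_negI_smul]
    calc ‖cj ((1 : Site d → Fin d → 𝔸ˣ) x κ) (lam (x + e κ)) - lam x‖ ≤ α₄ * ((L : ℝ) ^ (m + 1))⁻¹ := cjDiff_le_of_weighted hL1 hη hgrad
      _ < 2 * α₄ * ((L : ℝ) ^ (m + 1))⁻¹ := mul_lt_mul_of_pos_right (by linarith) hLj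
  -- the windows of the local inversion ∕ Prop. 10 at `(α₃ := 40·d·c_B, 2α₄)`
  have hw₁ : 10 * C6 d * (4 * (2 * α₄)) ≤ 1 := by nlinarith only [hs₁, hC6, hα₄.le]
  have hw₂ : 3000 * ((d : ℝ) + 1) * L * (4 * (2 * α₄)) ≤ 1 := by linarith only [hs₂]
  have hprod : 2 * C6 d * (40 * d * cB + 4 * (2 * α₄)) < 1 / 2 := by nlinarith only [hprod8, hC6, hα₃0, hα₄.le]
  have hα₄2 : 0 < 2 * α₄ := by positivity
  have hα₃50 : 40 * (d : ℝ) * cB ≤ 1 / 50 := by linarith only [hα₃']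
  have h33y := h33' (m + 1) hk y hy
  have hy₀ : tlo L y 0 ≤ y := by rw [tlo_zero]
  have hy₀' : y ≤ thi L y 0 := by rw [thi_zero]
  -- the witnesses of `u₁⁻¹` and of the product `e^{−iλ′}·u₁⁻¹`
  obtain ⟨uti, hWi, hagi⟩ := witness_inv_of_unitary hL hU₀ hα₀ hα3 hαP2 h33y hL1 hα₃0 (by linarith only [hα₃']) hun hWt hag
  obtain ⟨wt', hWw, hagw⟩ := witness_mul_of207 hL hG hU₀ hα₀ hα3 hαP2 h33y hL1 hWi hagi hα₄2 h177b h177a hα₃0 hα₃50 hw₁ hw₂ hs₃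
    hs₄ hs₅ hs₆
  -- §1 EXACT: `(R̄₀(u₁e^{iλ′}))^{m+1}(y) = (ũ′^{m+1}(e^{−iλ′}, u₁⁻¹)(y))⁻¹`
  have h1 := uavg_inv_tower_of_witness (u := (fun x => expUnit (((-I) • lam) x)) * u₁⁻¹) hL1 (by positivity) hprod hWw hagw
    (m := m + 1) (n := 0) (by omega) y hy₀ hy₀'
  have h2 := uavg_inv_tower_of_witness (u := u₁) hL1 hα₃0 hα₃h hWt hag (m := m + 1) (n := 0) (by omega) y hy₀ hy₀'
  have h129y : uavg L (1 : Site d → Fin d → 𝔸ˣ) u₁ (m + 1) y = 1 :=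
    (restr129_iff_uavg L (m + 1) (Λs (m + 1)) (1 : Site d → Fin d → 𝔸ˣ) u₁).1 h129' (m + 1) hk y hy
  have hprodId : uavg L (1 : Site d → Fin d → 𝔸ˣ) ((fun x => expUnit (((-I) • lam) x)) * u₁⁻¹) (m + 1) y =
      utilG L (1 : Site d → Fin d → 𝔸ˣ) (fun x => expUnit (((-I) • lam) x)) u₁⁻¹ (m + 1) y := by
    have h := congrFun (utilG_eq_uavg_mul_inv L (1 : Site d → Fin d → 𝔸ˣ) (fun x => expUnit (((-I) • lam) x)) u₁⁻¹ (m + 1)) y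
    rw [h2, h129y] at h
    simp only [inv_one, mul_one] at h
    exact h.symm
  have hfun : (fun x => expUnit (((-I) • lam) x))⁻¹ = gaugeExp lam := by
    funext x
    rw [Pi.inv_apply, val_inv_expUnit, Pi.smul_apply, neg_smul, neg_neg]
    rfl
  have hUeq : uavg L (1 : Site d → Fin d → 𝔸ˣ) (u₁ * gaugeExp lam) (m + 1) y =
      (utilG L (1 : Site d → Fin d → 𝔸ˣ) (fun x => expUnit (((-I) • lam) x)) u₁⁻¹ (m + 1) y)⁻¹ := by
    rw [← hfun, show u₁ * (fun x => expUnit (((-I) • lam) x))⁻¹ = ((fun x => expUnit (((-I) • lam) x)) * u₁⁻¹)⁻¹ by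
      rw [mul_inv_rev, inv_inv], h1, hprodId]
  -- (204) on the tower for the inverse pair: the log domain
  have hdom : ‖((utilG L (1 : Site d → Fin d → 𝔸ˣ) (fun x => expUnit (((-I) • lam) x)) u₁⁻¹ (m + 1) y : 𝔸ˣ) : 𝔸) - 1‖ ≤
      C6 d * (4 * (2 * α₄)) :=
    (B8Restr129InversionLocal.prop10_tower_of_witness hL hG hU₀ hα₀ hα3 hαP2 h33y hL1 hWi hagi hα₄2 h177b h177a hα₃0 hα₃50 hw₁ hw₂
      hs₃ hs₄ hs₅ hs₆ (m := m + 1) (n := 0) (by omega)).1 y hy₀ hy₀'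
  have hC6α : C6 d * (4 * (2 * α₄)) ≤ 1 / 50 := by nlinarith only [hs₁, hC6, hα₄.le]
  have hdom1 : ‖((utilG L (1 : Site d → Fin d → 𝔸ˣ) (fun x => expUnit (((-I) • lam) x)) u₁⁻¹ (m + 1) y : 𝔸ˣ) : 𝔸) - 1‖ < 1 := by
    linarith only [hdom, hC6α]
  have hdom2 : ‖((utilG L (1 : Site d → Fin d → 𝔸ˣ) (fun x => expUnit (((-I) • lam) x)) u₁⁻¹ (m + 1) y : 𝔸ˣ) : 𝔸) - 1‖ ≤ 1 / 2 := by
    linarith only [hdom, hC6α]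
  have hUexp : ((utilG L (1 : Site d → Fin d → 𝔸ˣ) (fun x => expUnit (((-I) • lam) x)) u₁⁻¹ (m + 1) y : 𝔸ˣ) : 𝔸) =
      exp (mlog ((utilG L (1 : Site d → Fin d → 𝔸ˣ) (fun x => expUnit (((-I) • lam) x)) u₁⁻¹ (m + 1) y : 𝔸ˣ) : 𝔸)) :=
    (exp_mlog hdom1).symm
  have hAa : ‖mlog ((utilG L (1 : Site d → Fin d → 𝔸ˣ) (fun x => expUnit (((-I) • lam) x)) u₁⁻¹ (m + 1) y : 𝔸ˣ) : 𝔸)‖ ≤ 1 / 25 :=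
    (norm_mlog_le_two_mul hdom2).trans (by linarith only [hdom, hC6α])
  -- (214) on the tower for the inverse pair
  have h214 := eq214_tower_of_witness hL hG hU₀ hα₀ hα3 hαP2 h33y hL1 hWi hagi hα₄2 h177b h177a hα₃0 hα₃' hs₁ hs₂ hs₃ hs₄ hs₅ hs₆ hs₇
    (m := m + 1) (n := 0) (by omega) y hy₀ hy₀'
  have hAB : ‖mlog ((utilG L (1 : Site d → Fin d → 𝔸ˣ) (fun x => expUnit (((-I) • lam) x)) u₁⁻¹ (m + 1) y : 𝔸ˣ) : 𝔸) - mlog (V : 𝔸)‖ ≤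
      C2p d * (40 * d * cB + 2 * α₄) * (2 * α₄) + CbT := by
    rw [← Qnl_eq_mlog_utilG]
    calc ‖Qnl L (1 : Site d → Fin d → 𝔸ˣ) (fun x => expUnit (((-I) • lam) x)) u₁⁻¹ (m + 1) y - mlog (V : 𝔸)‖
        ≤ ‖Qnl L (1 : Site d → Fin d → 𝔸ˣ) (fun x => expUnit (((-I) • lam) x)) u₁⁻¹ (m + 1) y -
              QprimeIter (zdBlocking d L) (bgT L (1 : Site d → Fin d → 𝔸ˣ)) (m + 1) ((-I) • lam) y‖ +
            ‖QprimeIter (zdBlocking d L) (bgT L (1 : Site d → Fin d → 𝔸ˣ)) (m + 1) ((-I) • lam) y - mlog (V : 𝔸)‖ :=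
          norm_sub_le_norm_sub_add_norm_sub _ _ _
      _ ≤ 16 * Cgen d * (40 * d * cB * (2 * α₄) + (2 * α₄) ^ 2) * ((L : ℝ) ^ (m + 1) * ((L : ℝ) ^ (m + 1))⁻¹) + CbT :=
          add_le_add h214 (by rw [norm_sub_rev]; exact hVQ)
      _ = C2p d * (40 * d * cB + 2 * α₄) * (2 * α₄) + CbT := by
          rw [mul_inv_cancel₀ hLk.ne', mul_one]; simp only [C2p]; ring
  -- conclude by §0
  have hfin := norm_inv_mul_sub_one_le_two_mul hUexp hV.symm hAa hAB le_rfl hwinT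
  rw [hUeq, ← Units.val_mul]
  exact hfin

end Core


end Summit.QuantumFields.YangMills.Theorems.HalvingTopCrossingDictionaryCore

end
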